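import Mathlib
import Summits.Ventures.HodgeRepro.Tier4.Target
import Summits.Ventures.HodgeRepro.Tier4.Line3.Defs
import Summits.Ventures.HodgeRepro.Tier4.Line3.ShrinkMajGauss
import Summits.Ventures.HodgeRepro.Tier4.Line3.QuarticProfile

/-!
# Tier4/Line3/QuarticShapeOfCard — a quartic CM field has the quartic shape

Blind re-derivation cell `pub-hodge-repro`, Tier 4 «PROVE THE STEP», LINE L3, seat t4-x2 (g3, reserve wall-breaker).
Discharges the display `QuarticShape` of QuarticProfile: when `E` has exactly four complex embeddings, the definite
embeddings (the complement of the pair `{τ₀, τ̄₀}`) are one conjugate pair `{σ₁, conjEmb σ₁}` — `conjEmb` is an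
involution without fixed points on a totally complex field, and it preserves the pair `{τ₀, τ̄₀}`, hence its complement.

Nothing here says anything about the status of the Hodge conjecture for CM abelian varieties, which is NOT proved
(HC_CM is NOT proved by anyone in this repository).
-/

set_option autoImplicit false

noncomputable section

namespace Summit.Ventures.HodgeRepro.Tier4.Line3

open Summit.Ventures.HodgeRepro.Tier4
open NumberField
open scoped ComplexConjugate
open scoped Classical

namespace T4Data

variable (X : T4Data)

/-- `conjEmb` is an involution. -/
theorem conjEmb_conjEmb (σ : X.E →+* ℂ) : conjEmb (conjEmb σ) = σ := by
  ext x
  show conj (conj (σ x)) = σ x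
  exact Complex.conj_conj _

/-- No embedding of the totally complex field is its own conjugate. -/
theorem ne_conjEmb_self (σ : X.E →+* ℂ) : σ ≠ conjEmb σ := by
  intro h
  have hnr : ¬ ComplexEmbedding.IsReal σ := IsTotallyComplex.complexEmbedding_not_isReal σ
  apply hnr
  rw [ComplexEmbedding.isReal_iff]
  have h' : conjEmb σ = ComplexEmbedding.conjugate σ := by ext x; rfl
  rw [← h']
  exact h.symm

/-- The conjugate of a definite embedding is definite. -/
theorem conjEmb_mem_defEmb {σ : X.E →+* ℂ} (hσ : σ ∈ X.defEmb) : conjEmb σ ∈ X.defEmb := by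
  simp only [defEmb, Finset.mem_filter, Finset.mem_univ, true_and] at hσ ⊢
  refine ⟨fun h => hσ.2 ?_, fun h => hσ.1 ?_⟩
  · rw [← X.conjEmb_conjEmb σ, h]
  · rw [← X.conjEmb_conjEmb σ, h, X.conjEmb_conjEmb]

/-- The definite embeddings number `card (E →+* ℂ) − 2`. -/
theorem card_defEmb : X.defEmb.card + 2 = Fintype.card (X.E →+* ℂ) := by
  have h := Finset.card_filter_add_card_filter_not (s := (Finset.univ : Finset (X.E →+* ℂ)))
    (fun σ : X.E →+* ℂ => σ ≠ X.τ₀ ∧ σ ≠ conjEmb X.τ₀)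
  rw [X.filter_not_def_eq, Finset.card_pair X.tau_ne_conjEmb, Finset.card_univ] at h
  exact h

/-- **A QUARTIC CM FIELD HAS THE QUARTIC SHAPE.** -/
theorem quarticShape_of_card (h4 : Fintype.card (X.E →+* ℂ) = 4) : X.QuarticShape := by
  have hcard : X.defEmb.card = 2 := by
    have := X.card_defEmb
    omega
  obtain ⟨σ₁, hσ₁⟩ : X.defEmb.Nonempty := Finset.card_pos.1 (by rw [hcard]; norm_num)
  refine ⟨σ₁, X.ne_conjEmb_self σ₁, ?_⟩
  symm
  apply Finset.eq_of_subset_of_card_le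
  · intro σ hσ
    rcases Finset.mem_insert.1 hσ with h | h
    · rw [h]; exact hσ₁
    · rw [Finset.mem_singleton.1 h]; exact X.conjEmb_mem_defEmb hσ₁
  · rw [hcard, Finset.card_pair (X.ne_conjEmb_self σ₁)]

end T4Data

end Summit.Ventures.HodgeRepro.Tier4.Line3

end
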